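import Literature.MathematicalPhysics.QuantumLattice.ShibaThermalKernelDecay
import Literature.MathematicalPhysics.QuantumLattice.OnSiteQuarticLinkedCluster
import HarnessLib

/-!
# Finite-temperature perturbation theory of the `d`-wave–SOURCED Hubbard torus converges uniformly in the volume

The sourced companion of `HubbardTorusSingleScalePressure.lean`. After the Shiba/Lieb transform the
partition function of `dWaveSourceTorus L U μ h` is `e^{βμL²}` times that of
`dΓ(𝓚) - U Σ_x c†_{x↑}c_{x↑}c†_{x↓}c_{x↓}`, `𝓚 = shibaOneBody τ_L Δ_{L,h} μ U` (the pair source and the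
Hartree term `U·P_↑` INSIDE the one-body operator; `DWaveSourceDysonSeries`). The determinant-bound
single-scale chain (`VacuumConnectedCoeffBound`, `VacuumLinkedCluster`, `ExpRecursionPowerSeries`) is
generic in the one-body operator: it needs only a translation-invariant line bound on the chronological
propagator matrices of `𝓚`, which `ShibaThermalKernelDecay.exists_norm_shibaThermalKernel_apply_le`
supplies for `|h|, |U| ≤ κ(β, μ)` (Dyson-equation bootstrap around the free Nambu kernel). PROVED here:

* `fermiKernel_creationFirst_eq`, `fermiKernel_annihilationFirst_eq` — the two chronological kernels of
  the tree's `propMatrix` are thermal kernels `Γ_𝓚(τ) = e^{-τ𝓚}(1+e^{-β𝓚})⁻¹` at `τ ∈ [0, β]`;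
* `norm_vacuumPropMatrix_shiba_apply_le` — hence the line bound `hG` of `norm_vacuumConnectedCoeff_le`
  for `𝓚`, with weight `γ(u) = C'(1+|u|_L)^{-4}`;
* **`dWaveSourceTorus_connectedCoeff_bound_and_exp`** — for every `β ≥ 0`, `μ` there are `κ, R > 0`,
  `A ≥ 0` such that for all `L ≥ 3`, `|h| ≤ κ`, `|U| ≤ κ`: (i) the connected coefficients of the Shiba
  expansion obey `‖c_j(L; U, h)‖ ≤ L² A R^{-j}` (`j ≥ 1`), uniformly in `L` AND in the source; (ii) for
  complex `|z| < R` the Dyson series of `Tr e^{-β(dΓ(𝓚) + zD)}` resums to `Z₀(𝓚) exp(Σ_j c_j z^j)`;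
* **`partitionFn_dWaveSourceTorus_eq_exp_connected`** — in particular, for real `|U| < R`,
  `Tr e^{-β·dWaveSourceTorus L U μ h} = e^{βμL²} Z₀(𝓚) exp(Σ_j c_j(L;U,h) (-U)^j)` with
  `|Σ_j c_j (-U)^j| ≤ L² A Σ_j (|U|/R)^j`: the interaction correction to the SOURCED pressure is `O(|U|)`
  uniformly in the volume and in the source `|h| ≤ κ` — the single-scale (fixed-temperature) layer of the
  sourced expansion of the route ThermalWedge (the radius `R(β, μ)` is that of the bare series, `∝ T`;
  the window `β ≤ e^{a/U}` needs the multiscale analysis of Benfatto–Giuliani–Mastropietro 2006).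

Everything is PROVED; no definition and no named fact (the Shiba one-body operator
`𝓚 = shibaOneBody τ_L Δ_{L,h} μ U` is spelled out in full, exactly as in `DWaveSourceDysonSeries`).

## References

* G. Benfatto, A. Giuliani, V. Mastropietro, Ann. Henri Poincaré 7 (2006) 809–898, §2.1–2.2, (2.77).
  [cite: BenfattoGiulianiMastropietro2006, (2.77)]
* E. H. Lieb, Phys. Rev. Lett. 62 (1989) 1201–1204, proof of Thm 2 (the partial particle–hole
  transformation). [cite: Lieb1989, proof of Theorem 2]
* W. de Siqueira Pedra, M. Salmhofer, Comm. Math. Phys. 282 (2008) 797–818, Thm 2.4.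
  [cite: PedraSalmhofer2008, Thm 2.4]
-/

noncomputable section

open scoped Matrix.Norms.L2Operator ComplexOrder
open Finset MeasureTheory Filter Topology NormedSpace Set
open Literature.Probability.LatticeModels
open Literature.Probability.LatticeModels.BattleFederbush

namespace Literature.MathematicalPhysics.QuantumLattice

-- the generic `DecidableEq` path on `Orb (FermionTorus 2 L)` (cf. `ShibaFreeThermalKernel`)
attribute [-instance] instDecidableEqLex

/-! ### §1 The chronological kernels are thermal kernels -/

section Kernels

variable {ι : Type*} [LinearOrder ι] [Fintype ι] {H : Matrix ι ι ℂ}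

/-- **Creation-first kernel**: `e^{-sH}(1+e^{βH})⁻¹e^{tH} = Γ_H(β - (t - s))`,
`Γ_H(τ) = e^{-τH}(1+e^{-βH})⁻¹` (Hermitian `H`, real `β, s, t`). [folklore] -/
theorem fermiKernel_creationFirst_eq (hH : H.IsHermitian) (β s t : ℝ) :
    exp (-(((s : ℝ) : ℂ) • H)) * (1 + exp ((β : ℂ) • H))⁻¹ * exp (((t : ℝ) : ℂ) • H) =
      exp ((-(β - (t - s))) • H) * (1 + exp ((-β) • H))⁻¹ := by
  have hF : (1 + exp ((-β) • H))⁻¹ = exp (β • H) * (1 + exp (β • H))⁻¹ := by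
    have h := inv_one_add_exp_neg_smul hH β
    rw [Complex.coe_smul, ← neg_smul] at h
    exact h
  rw [Complex.coe_smul, Complex.coe_smul, Complex.coe_smul, ← neg_smul, hF, mul_assoc,
    Matrix.inv_one_add_exp_smul_mul_exp_smul_comm hH β t, ← mul_assoc, ← mul_assoc,
    ← Matrix.exp_add_of_commute _ _ (((Commute.refl H).smul_left _).smul_right _),
    ← Matrix.exp_add_of_commute _ _ (((Commute.refl H).smul_left _).smul_right _),
    ← add_smul, ← add_smul]
  congr 2
  ring

/-- **Annihilation-first kernel**: `e^{-sH}(1+e^{-βH})⁻¹e^{tH} = Γ_H(s - t)`. [folklore] -/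
theorem fermiKernel_annihilationFirst_eq (hH : H.IsHermitian) (β s t : ℝ) :
    exp (-(((s : ℝ) : ℂ) • H)) * (1 + exp (-((β : ℂ) • H)))⁻¹ * exp (((t : ℝ) : ℂ) • H) =
      exp ((-(s - t)) • H) * (1 + exp ((-β) • H))⁻¹ := by
  rw [Complex.coe_smul, Complex.coe_smul, Complex.coe_smul, ← neg_smul, ← neg_smul, mul_assoc,
    Matrix.inv_one_add_exp_smul_mul_exp_smul_comm hH (-β) t, ← mul_assoc,
    ← Matrix.exp_add_of_commute _ _ (((Commute.refl H).smul_left _).smul_right _), ← add_smul]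
  congr 2
  ring

end Kernels

/-! ### §2 The line bound for the chronological propagator matrices of `𝓚` -/

section LineBound

variable (β μ : ℝ) {L : ℕ} [NeZero L]

/-- **The line bound `hG` of `norm_vacuumConnectedCoeff_le` for the Shiba one-body operator**: if the
thermal kernel of `𝓚 = (shibaOneBody (fun x y : FermionTorus 2 L => if (fermionTorusGraph 2 L).Adj x y then -(1 : ℂ) else 0)
          (fun u v : FermionTorus 2 L => -(h : ℂ) * ∑ i : Fin 2,
            if v = FermionTorus.ofTorusSite (u.toTorusSite + Pi.single i 1) then
              ((Real.sqrt 2 * (if i = 0 then 1 else -1) : ℝ) : ℂ) else 0) μ (U : ℂ))` obeys `‖Γ_𝓚(τ) (v,σ') (u,σ)‖ ≤ C'(1+|v̄-ū|_L)^{-4}` for all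
`τ ∈ [0, β]`, then for simplex times `v ∈ [0,1]^j` monotone, vertex sites `g` and pairs `f, f'`,
`‖G'(f, f')‖ ≤ C'(1+|ḡ_{v(f)} - ḡ_{v(f')}|_L)^{-4}`. [cite: BenfattoGiulianiMastropietro2006, §2.2] -/
theorem norm_vacuumPropMatrix_shiba_apply_le (hβ : 0 ≤ β) (h U C' : ℝ)
    (hΓ : ∀ τ ∈ Icc (0 : ℝ) β, ∀ (u w : FermionTorus 2 L) (σ σ' : Fin 2),
      ‖(exp ((-τ) • (shibaOneBody (fun x y : FermionTorus 2 L => if (fermionTorusGraph 2 L).Adj x y then -(1 : ℂ) else 0)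
          (fun u v : FermionTorus 2 L => -(h : ℂ) * ∑ i : Fin 2,
            if v = FermionTorus.ofTorusSite (u.toTorusSite + Pi.single i 1) then
              ((Real.sqrt 2 * (if i = 0 then 1 else -1) : ℝ) : ℂ) else 0) μ (U : ℂ))) * (1 + exp ((-β) • (shibaOneBody (fun x y : FermionTorus 2 L => if (fermionTorusGraph 2 L).Adj x y then -(1 : ℂ) else 0)
          (fun u v : FermionTorus 2 L => -(h : ℂ) * ∑ i : Fin 2,
            if v = FermionTorus.ofTorusSite (u.toTorusSite + Pi.single i 1) then
              ((Real.sqrt 2 * (if i = 0 then 1 else -1) : ℝ) : ℂ) else 0) μ (U : ℂ))))⁻¹) (orb w σ') (orb u σ)‖ ≤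
        C' * ((1 + (Torus.tnorm (FermionTorus.toTorusSite w - FermionTorus.toTorusSite u) : ℝ)) ^ 4)⁻¹)
    {j : ℕ} (v : Fin j → ℝ) (hvm : Monotone v) (hv01 : ∀ i, v i ∈ Icc (0 : ℝ) 1)
    (g : Fin j → FermionTorus 2 L) (f f' : Fin (j * 2)) :
    ‖vacuumPropMatrix β ((shibaOneBody (fun x y : FermionTorus 2 L => if (fermionTorusGraph 2 L).Adj x y then -(1 : ℂ) else 0)
          (fun u v : FermionTorus 2 L => -(h : ℂ) * ∑ i : Fin 2,
            if v = FermionTorus.ofTorusSite (u.toTorusSite + Pi.single i 1) then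
              ((Real.sqrt 2 * (if i = 0 then 1 else -1) : ℝ) : ℂ) else 0) μ (U : ℂ))) g (fun i => ((v i : ℝ) : ℂ) * -(β : ℂ)) f f'‖ ≤
      C' * ((1 + (Torus.tnorm (FermionTorus.toTorusSite (g (vacuumCluster j f)) -
        FermionTorus.toTorusSite (g (vacuumCluster j f'))) : ℝ)) ^ 4)⁻¹ := by
  have hK : ((shibaOneBody (fun x y : FermionTorus 2 L => if (fermionTorusGraph 2 L).Adj x y then -(1 : ℂ) else 0)
          (fun u v : FermionTorus 2 L => -(h : ℂ) * ∑ i : Fin 2,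
            if v = FermionTorus.ofTorusSite (u.toTorusSite + Pi.single i 1) then
              ((Real.sqrt 2 * (if i = 0 then 1 else -1) : ℝ) : ℂ) else 0) μ (U : ℂ))).IsHermitian := by
    refine isHermitian_shibaOneBody (fun x y => ?_) _ μ U
    simp only [apply_ite star, star_neg, star_one, star_zero, (fermionTorusGraph 2 L).adj_comm x y]
  obtain ⟨hanti, hwin⟩ := vacuum_times_antitone_window (j := j) hβ hvm hv01
  -- the times are real: `t_p = v_{⌊p/2⌋} · (-β) ∈ [-β, 0]`, antitone in `p`
  have htime : ∀ i, ((v i : ℝ) : ℂ) * -(β : ℂ) = (((v i * -β : ℝ)) : ℂ) := fun i => by push_cast; ring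
  unfold vacuumPropMatrix propMatrix
  rw [Matrix.of_apply]
  simp only [htime]
  have hf := hwin f
  have hf' := hwin f'
  by_cases hff : f ≤ f'
  · -- creation-first: `Γ(β - (t_f - t_{f'}))`, `t_f - t_{f'} ∈ [0, β]`
    rw [if_pos hff, fermiKernel_creationFirst_eq hK]
    have hd : 0 ≤ v (finProdFinEquiv.symm f).1 * -β - v (finProdFinEquiv.symm f').1 * -β := by
      have := hanti hff; linarith
    have hτ : β - (v (finProdFinEquiv.symm f).1 * -β - v (finProdFinEquiv.symm f').1 * -β) ∈ Icc (0:ℝ) β :=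
      ⟨by linarith [hf.1, hf.2, hf'.1, hf'.2], by linarith⟩
    refine (hΓ _ hτ _ _ _ _).trans (le_of_eq ?_)
    simp only [vacuumCluster]
    rw [← Torus.tnorm_neg, neg_sub]
  · -- annihilation-first: `-Γ(t_{f'} - t_f)`, `t_{f'} - t_f ∈ [0, β]`
    rw [if_neg hff, norm_neg, fermiKernel_annihilationFirst_eq hK]
    have hlt : f' ≤ f := le_of_not_ge hff
    have hd : 0 ≤ v (finProdFinEquiv.symm f').1 * -β - v (finProdFinEquiv.symm f).1 * -β := by
      have := hanti hlt; linarith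
    have hτ : v (finProdFinEquiv.symm f').1 * -β - v (finProdFinEquiv.symm f).1 * -β ∈ Icc (0:ℝ) β :=
      ⟨hd, by linarith [hf.1, hf.2, hf'.1, hf'.2]⟩
    refine (hΓ _ hτ _ _ _ _).trans (le_of_eq ?_)
    simp only [vacuumCluster]
    rw [← Torus.tnorm_neg, neg_sub]

end LineBound

/-! ### §3 The connected coefficients and the exponential resummation -/

section Coefficients

variable (β μ : ℝ)

/-- **The single-scale bound on the connected coefficients of the SOURCED torus pressure and the
exponential resummation, uniformly in the volume and in the source.** For every `β ≥ 0` and `μ` there are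
`κ > 0`, `R > 0`, `A ≥ 0` such that for all `L ≥ 3` and all real `h, U` with `|h| ≤ κ`, `|U| ≤ κ`:
(i) the connected coefficients `c_j(L; U, h)` of the Shiba determinant expansion obey
`‖c_j‖ ≤ L² · A · R^{-j}` for `j ≥ 1`; (ii) for every complex `|z| < R` the Dyson series of
`Tr e^{-β(dΓ(𝓚) + zD)}` (`D` the on-site quartic word) resums to `Z₀(𝓚) · exp(Σ_j c_j z^j)`.
[cite: BenfattoGiulianiMastropietro2006, (2.77)] -/
theorem dWaveSourceTorus_connectedCoeff_bound_and_exp (hβ : 0 ≤ β) :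
    ∃ κ : ℝ, 0 < κ ∧ ∃ R : ℝ, 0 < R ∧ ∃ A : ℝ, 0 ≤ A ∧ ∀ (L : ℕ) [NeZero L], 3 ≤ L →
      ∀ (h U : ℝ), |h| ≤ κ → |U| ≤ κ →
      (∀ j : ℕ, 1 ≤ j →
        ‖orderedIntegral j (fun v : Fin j → ℝ => (-(β : ℂ)) ^ j * ∑ g : Fin j → FermionTorus 2 L,
            ursellOf (FermionicTree.moment (vacuumCluster j)
              (vacuumPropMatrix β ((shibaOneBody (fun x y : FermionTorus 2 L => if (fermionTorusGraph 2 L).Adj x y then -(1 : ℂ) else 0)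
          (fun u v : FermionTorus 2 L => -(h : ℂ) * ∑ i : Fin 2,
            if v = FermionTorus.ofTorusSite (u.toTorusSite + Pi.single i 1) then
              ((Real.sqrt 2 * (if i = 0 then 1 else -1) : ℝ) : ℂ) else 0) μ (U : ℂ))) g (fun i => ((v i : ℝ) : ℂ) * -(β : ℂ)))) univ) 1‖ ≤
          (L : ℝ) ^ 2 * A * R⁻¹ ^ j) ∧
      ∀ z : ℂ, ‖z‖ < R →
        HasSum (fun m : ℕ => z ^ m * orderedIntegral m (vacuumIntegrand β ((shibaOneBody (fun x y : FermionTorus 2 L => if (fermionTorusGraph 2 L).Adj x y then -(1 : ℂ) else 0)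
          (fun u v : FermionTorus 2 L => -(h : ℂ) * ∑ i : Fin 2,
            if v = FermionTorus.ofTorusSite (u.toTorusSite + Pi.single i 1) then
              ((Real.sqrt 2 * (if i = 0 then 1 else -1) : ℝ) : ℂ) else 0) μ (U : ℂ)))
            (Matrix.partitionFn β (dGamma ((shibaOneBody (fun x y : FermionTorus 2 L => if (fermionTorusGraph 2 L).Adj x y then -(1 : ℂ) else 0)
          (fun u v : FermionTorus 2 L => -(h : ℂ) * ∑ i : Fin 2,
            if v = FermionTorus.ofTorusSite (u.toTorusSite + Pi.single i 1) then
              ((Real.sqrt 2 * (if i = 0 then 1 else -1) : ℝ) : ℂ) else 0) μ (U : ℂ))))) m) 1)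
          (Matrix.partitionFn β (dGamma ((shibaOneBody (fun x y : FermionTorus 2 L => if (fermionTorusGraph 2 L).Adj x y then -(1 : ℂ) else 0)
          (fun u v : FermionTorus 2 L => -(h : ℂ) * ∑ i : Fin 2,
            if v = FermionTorus.ofTorusSite (u.toTorusSite + Pi.single i 1) then
              ((Real.sqrt 2 * (if i = 0 then 1 else -1) : ℝ) : ℂ) else 0) μ (U : ℂ)))) *
            Complex.exp (∑' j : ℕ, (if j = 0 then 0 else
              orderedIntegral j (fun v : Fin j → ℝ => (-(β : ℂ)) ^ j * ∑ g : Fin j → FermionTorus 2 L,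
                ursellOf (FermionicTree.moment (vacuumCluster j)
                  (vacuumPropMatrix β ((shibaOneBody (fun x y : FermionTorus 2 L => if (fermionTorusGraph 2 L).Adj x y then -(1 : ℂ) else 0)
          (fun u v : FermionTorus 2 L => -(h : ℂ) * ∑ i : Fin 2,
            if v = FermionTorus.ofTorusSite (u.toTorusSite + Pi.single i 1) then
              ((Real.sqrt 2 * (if i = 0 then 1 else -1) : ℝ) : ℂ) else 0) μ (U : ℂ))) g (fun i => ((v i : ℝ) : ℂ) * -(β : ℂ)))) univ) 1) *
              z ^ j)) := by
  classical
  -- the decay of the thermal kernel of `𝓚` for small `h, U`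
  obtain ⟨κ, hκ, C', hC'0, hΓ⟩ := exists_norm_shibaThermalKernel_apply_le β μ hβ
  set S : ℝ := ∑' z : Site 2, ((1 + ‖z‖) ^ 4)⁻¹ with hS
  have hS0 : 0 ≤ S := tsum_nonneg fun z => by positivity
  -- the constants (as in `hubbardTorus_partitionFn_eq_exp_connected`, with `C S` replaced by `C' S + 1`)
  set CS : ℝ := C' * S + 1 with hCS
  have hCSpos : 0 < CS := by positivity
  set ϱ : ℝ := 32 * Real.exp 1 * β * CS + 1 with hϱ
  have hϱ1 : 1 ≤ ϱ := by
    have : 0 ≤ 32 * Real.exp 1 * β * CS := by positivity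
    linarith
  have hϱpos : 0 < ϱ := by linarith
  refine ⟨κ, hκ, ϱ⁻¹, by positivity, (8 * CS)⁻¹ + 1, by positivity, ?_⟩
  intro L _ hL h U hh hU
  have hK : ((shibaOneBody (fun x y : FermionTorus 2 L => if (fermionTorusGraph 2 L).Adj x y then -(1 : ℂ) else 0)
          (fun u v : FermionTorus 2 L => -(h : ℂ) * ∑ i : Fin 2,
            if v = FermionTorus.ofTorusSite (u.toTorusSite + Pi.single i 1) then
              ((Real.sqrt 2 * (if i = 0 then 1 else -1) : ℝ) : ℂ) else 0) μ (U : ℂ))).IsHermitian := by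
    refine isHermitian_shibaOneBody (fun x y => ?_) _ μ U
    simp only [apply_ite star, star_neg, star_one, star_zero, (fermionTorusGraph 2 L).adj_comm x y]
  -- sites ↔ torus points, and the line weight
  set pos : FermionTorus 2 L ≃ TorusSite 2 L :=
    ⟨FermionTorus.toTorusSite, FermionTorus.ofTorusSite, FermionTorus.ofTorusSite_toTorusSite,
      FermionTorus.toTorusSite_ofTorusSite⟩ with hpos
  set γ : TorusSite 2 L → ℝ := fun u => C' * ((1 + (Torus.tnorm u : ℝ)) ^ 4)⁻¹ with hγ
  have hγ0 : ∀ u, 0 ≤ γ u := fun u => by positivity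
  have hγeven : ∀ u, γ (-u) = γ u := fun u => by simp only [hγ, Torus.tnorm_neg]
  have hsumγ : ∑ u, γ u ≤ C' * S := by
    simp only [hγ]
    rw [← Finset.mul_sum]
    exact mul_le_mul_of_nonneg_left (sum_inv_one_add_tnorm_pow_le_tsum (L := L) le_rfl) hC'0
  have hsumγ' : ∑ u, γ u ≤ CS := hsumγ.trans (by rw [hCS]; linarith)
  have hsumγ0 : 0 ≤ ∑ u, γ u := sum_nonneg fun u _ => hγ0 u
  -- (i) the geometric bound on the connected coefficients
  have hcoef : ∀ j : ℕ, 1 ≤ j →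
      ‖orderedIntegral j (fun v : Fin j → ℝ => (-(β : ℂ)) ^ j * ∑ g : Fin j → FermionTorus 2 L,
          ursellOf (FermionicTree.moment (vacuumCluster j)
            (vacuumPropMatrix β ((shibaOneBody (fun x y : FermionTorus 2 L => if (fermionTorusGraph 2 L).Adj x y then -(1 : ℂ) else 0)
          (fun u v : FermionTorus 2 L => -(h : ℂ) * ∑ i : Fin 2,
            if v = FermionTorus.ofTorusSite (u.toTorusSite + Pi.single i 1) then
              ((Real.sqrt 2 * (if i = 0 then 1 else -1) : ℝ) : ℂ) else 0) μ (U : ℂ))) g (fun i => ((v i : ℝ) : ℂ) * -(β : ℂ)))) univ) 1‖ ≤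
        (L : ℝ) ^ 2 * ((8 * CS)⁻¹ + 1) * ϱ⁻¹⁻¹ ^ j := by
    intro j hj
    rw [inv_inv]
    have key := norm_vacuumConnectedCoeff_le β ((shibaOneBody (fun x y : FermionTorus 2 L => if (fermionTorusGraph 2 L).Adj x y then -(1 : ℂ) else 0)
          (fun u v : FermionTorus 2 L => -(h : ℂ) * ∑ i : Fin 2,
            if v = FermionTorus.ofTorusSite (u.toTorusSite + Pi.single i 1) then
              ((Real.sqrt 2 * (if i = 0 then 1 else -1) : ℝ) : ℂ) else 0) μ (U : ℂ))) hK hβ pos γ hγ0 hγeven hj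
      (fun v hvm hv01 g f f' => norm_vacuumPropMatrix_shiba_apply_le β μ hβ h U C'
        (hΓ L hL h U hh hU) v hvm hv01 g f f')
    refine key.trans ?_
    have hcard : (Fintype.card (TorusSite 2 L) : ℝ) = (L : ℝ) ^ 2 := by
      rw [show Fintype.card (TorusSite 2 L) = L ^ 2 by
        simp only [TorusSite, Fintype.card_pi, ZMod.card, Finset.prod_const, Finset.card_univ,
          Fintype.card_fin]]
      push_cast
      ring
    rw [hcard]
    have hL2 : (0 : ℝ) ≤ (L : ℝ) ^ 2 := by positivity
    rw [mul_assoc, mul_assoc]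
    refine mul_le_mul_of_nonneg_left ?_ hL2
    -- `β^j/j! · j^{j-2} · 4^j · (8Σγ)^{j-1} ≤ ((8CS)⁻¹ + 1) · ϱ^j`
    have hjR : (1 : ℝ) ≤ j := by exact_mod_cast hj
    have hfact : (j : ℝ) ^ (j - 2) / j.factorial ≤ Real.exp 1 ^ j := by
      calc (j : ℝ) ^ (j - 2) / j.factorial ≤ (j : ℝ) ^ j / j.factorial :=
            div_le_div_of_nonneg_right (pow_le_pow_right₀ hjR (Nat.sub_le j 2)) (by positivity)
        _ ≤ Real.exp j := Real.pow_div_factorial_le_exp (x := (j : ℝ)) (by positivity) j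
        _ = Real.exp 1 ^ j := by rw [← Real.exp_nat_mul, mul_one]
    have h4 : (2 : ℝ) ^ (j * 2) = 4 ^ j := by rw [mul_comm, pow_mul]; norm_num
    have hne : (8 * CS) ≠ 0 := by positivity
    have h8 : (8 * ∑ u, γ u) ^ (j - 1) ≤ (8 * CS) ^ j * (8 * CS)⁻¹ := by
      have h1 : (8 * ∑ u, γ u) ^ (j - 1) ≤ (8 * CS) ^ (j - 1) :=
        pow_le_pow_left₀ (by positivity) (by linarith) _
      have h2 : (8 * CS) ^ (j - 1) = (8 * CS) ^ j * (8 * CS)⁻¹ := by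
        rw [eq_mul_inv_iff_mul_eq₀ hne, ← pow_succ, Nat.sub_add_cancel hj]
      rw [← h2]; exact h1
    calc β ^ j / j.factorial * ((j : ℝ) ^ (j - 2) * ((2 : ℝ) ^ (j * 2) * (8 * ∑ u, γ u) ^ (j - 1)))
        = ((j : ℝ) ^ (j - 2) / j.factorial) * (β ^ j * 4 ^ j) * (8 * ∑ u, γ u) ^ (j - 1) := by
          rw [h4]; ring
      _ ≤ Real.exp 1 ^ j * (β ^ j * 4 ^ j) * ((8 * CS) ^ j * (8 * CS)⁻¹) := by
          gcongr
      _ = (8 * CS)⁻¹ * (32 * Real.exp 1 * β * CS) ^ j := by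
          have h32 : (32 : ℝ) ^ j = 4 ^ j * 8 ^ j := by rw [← mul_pow]; norm_num
          simp only [mul_pow]
          rw [h32]
          ring
      _ ≤ ((8 * CS)⁻¹ + 1) * ϱ ^ j := by
          gcongr
          · linarith [inv_nonneg.mpr (by positivity : (0 : ℝ) ≤ 8 * CS)]
          · rw [hϱ]; linarith
  refine ⟨hcoef, fun z hz => ?_⟩
  -- (ii) the exponential resummation
  have hbsum : ∀ r : ℝ, 0 ≤ r → r < ϱ⁻¹ →
      Summable fun k => ‖orderedIntegral k (vacuumIntegrand β ((shibaOneBody (fun x y : FermionTorus 2 L => if (fermionTorusGraph 2 L).Adj x y then -(1 : ℂ) else 0)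
          (fun u v : FermionTorus 2 L => -(h : ℂ) * ∑ i : Fin 2,
            if v = FermionTorus.ofTorusSite (u.toTorusSite + Pi.single i 1) then
              ((Real.sqrt 2 * (if i = 0 then 1 else -1) : ℝ) : ℂ) else 0) μ (U : ℂ)))
        (Matrix.partitionFn β (dGamma ((shibaOneBody (fun x y : FermionTorus 2 L => if (fermionTorusGraph 2 L).Adj x y then -(1 : ℂ) else 0)
          (fun u v : FermionTorus 2 L => -(h : ℂ) * ∑ i : Fin 2,
            if v = FermionTorus.ofTorusSite (u.toTorusSite + Pi.single i 1) then
              ((Real.sqrt 2 * (if i = 0 then 1 else -1) : ℝ) : ℂ) else 0) μ (U : ℂ))))) k) 1‖ * r ^ k := by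
    intro r hr _
    refine (summable_norm_vacuumIntegrand hK β r).congr fun k => ?_
    rw [norm_mul, norm_pow, Complex.norm_real, Real.norm_of_nonneg hr, mul_comm]
  have hcsum : ∀ r : ℝ, 0 ≤ r → r < ϱ⁻¹ → Summable fun j : ℕ =>
      ‖(if j = 0 then 0 else
        orderedIntegral j (fun v : Fin j → ℝ => (-(β : ℂ)) ^ j * ∑ g : Fin j → FermionTorus 2 L,
          ursellOf (FermionicTree.moment (vacuumCluster j)
            (vacuumPropMatrix β ((shibaOneBody (fun x y : FermionTorus 2 L => if (fermionTorusGraph 2 L).Adj x y then -(1 : ℂ) else 0)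
          (fun u v : FermionTorus 2 L => -(h : ℂ) * ∑ i : Fin 2,
            if v = FermionTorus.ofTorusSite (u.toTorusSite + Pi.single i 1) then
              ((Real.sqrt 2 * (if i = 0 then 1 else -1) : ℝ) : ℂ) else 0) μ (U : ℂ))) g (fun i => ((v i : ℝ) : ℂ) * -(β : ℂ)))) univ) 1)‖ * r ^ j := by
    intro r hr hrR
    have hq : r * ϱ < 1 := by
      have := mul_lt_mul_of_pos_right hrR hϱpos
      rwa [inv_mul_cancel₀ hϱpos.ne'] at this
    have hgeo : Summable fun j : ℕ => (L : ℝ) ^ 2 * ((8 * CS)⁻¹ + 1) * (r * ϱ) ^ j :=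
      (summable_geometric_of_lt_one (by positivity) hq).mul_left _
    refine Summable.of_nonneg_of_le (fun j => by positivity) (fun j => ?_) hgeo
    by_cases hj0 : j = 0
    · subst hj0
      simp only [if_true, norm_zero, pow_zero, mul_one]
      positivity
    · have hj : 1 ≤ j := Nat.one_le_iff_ne_zero.mpr hj0
      have hcj := hcoef j hj
      rw [inv_inv] at hcj
      rw [if_neg hj0]
      calc _ ≤ (L : ℝ) ^ 2 * ((8 * CS)⁻¹ + 1) * ϱ ^ j * r ^ j :=
            mul_le_mul_of_nonneg_right hcj (pow_nonneg hr _)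
        _ = (L : ℝ) ^ 2 * ((8 * CS)⁻¹ + 1) * (r * ϱ) ^ j := by rw [mul_pow]; ring
  have hc0 : ((if (0:ℕ) = 0 then 0 else
        orderedIntegral 0 (fun v : Fin 0 → ℝ => (-(β : ℂ)) ^ 0 * ∑ g : Fin 0 → FermionTorus 2 L,
          ursellOf (FermionicTree.moment (vacuumCluster 0)
            (vacuumPropMatrix β ((shibaOneBody (fun x y : FermionTorus 2 L => if (fermionTorusGraph 2 L).Adj x y then -(1 : ℂ) else 0)
          (fun u v : FermionTorus 2 L => -(h : ℂ) * ∑ i : Fin 2,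
            if v = FermionTorus.ofTorusSite (u.toTorusSite + Pi.single i 1) then
              ((Real.sqrt 2 * (if i = 0 then 1 else -1) : ℝ) : ℂ) else 0) μ (U : ℂ))) g (fun i => ((v i : ℝ) : ℂ) * -(β : ℂ)))) univ) 1) : ℂ) = 0 :=
    if_pos rfl
  -- the recursion `k b_k = Σ j c_j b_{k-j}` (`VacuumLinkedCluster`)
  have hrec : ∀ k : ℕ, (k : ℂ) * orderedIntegral k (vacuumIntegrand β ((shibaOneBody (fun x y : FermionTorus 2 L => if (fermionTorusGraph 2 L).Adj x y then -(1 : ℂ) else 0)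
          (fun u v : FermionTorus 2 L => -(h : ℂ) * ∑ i : Fin 2,
            if v = FermionTorus.ofTorusSite (u.toTorusSite + Pi.single i 1) then
              ((Real.sqrt 2 * (if i = 0 then 1 else -1) : ℝ) : ℂ) else 0) μ (U : ℂ)))
      (Matrix.partitionFn β (dGamma ((shibaOneBody (fun x y : FermionTorus 2 L => if (fermionTorusGraph 2 L).Adj x y then -(1 : ℂ) else 0)
          (fun u v : FermionTorus 2 L => -(h : ℂ) * ∑ i : Fin 2,
            if v = FermionTorus.ofTorusSite (u.toTorusSite + Pi.single i 1) then
              ((Real.sqrt 2 * (if i = 0 then 1 else -1) : ℝ) : ℂ) else 0) μ (U : ℂ))))) k) 1 =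
      ∑ p ∈ antidiagonal k, (p.1 : ℂ) * (if p.1 = 0 then 0 else
        orderedIntegral p.1 (fun v : Fin p.1 → ℝ => (-(β : ℂ)) ^ p.1 * ∑ g : Fin p.1 → FermionTorus 2 L,
          ursellOf (FermionicTree.moment (vacuumCluster p.1)
            (vacuumPropMatrix β ((shibaOneBody (fun x y : FermionTorus 2 L => if (fermionTorusGraph 2 L).Adj x y then -(1 : ℂ) else 0)
          (fun u v : FermionTorus 2 L => -(h : ℂ) * ∑ i : Fin 2,
            if v = FermionTorus.ofTorusSite (u.toTorusSite + Pi.single i 1) then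
              ((Real.sqrt 2 * (if i = 0 then 1 else -1) : ℝ) : ℂ) else 0) μ (U : ℂ))) g (fun i => ((v i : ℝ) : ℂ) * -(β : ℂ)))) univ) 1) *
        orderedIntegral p.2 (vacuumIntegrand β ((shibaOneBody (fun x y : FermionTorus 2 L => if (fermionTorusGraph 2 L).Adj x y then -(1 : ℂ) else 0)
          (fun u v : FermionTorus 2 L => -(h : ℂ) * ∑ i : Fin 2,
            if v = FermionTorus.ofTorusSite (u.toTorusSite + Pi.single i 1) then
              ((Real.sqrt 2 * (if i = 0 then 1 else -1) : ℝ) : ℂ) else 0) μ (U : ℂ)))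
          (Matrix.partitionFn β (dGamma ((shibaOneBody (fun x y : FermionTorus 2 L => if (fermionTorusGraph 2 L).Adj x y then -(1 : ℂ) else 0)
          (fun u v : FermionTorus 2 L => -(h : ℂ) * ∑ i : Fin 2,
            if v = FermionTorus.ofTorusSite (u.toTorusSite + Pi.single i 1) then
              ((Real.sqrt 2 * (if i = 0 then 1 else -1) : ℝ) : ℂ) else 0) μ (U : ℂ))))) p.2) 1 := by
    intro k
    rw [vacuum_linkedCluster_recursion]
    refine Finset.sum_congr rfl fun p _ => ?_
    by_cases hp : p.1 = 0
    · simp only [hp, Nat.cast_zero, zero_mul]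
    · rw [if_neg hp]
  -- `Z = Z(0) e^C` on `|z| < ϱ⁻¹`
  have key := Literature.Analysis.Complex.tsum_eq_mul_exp_tsum_of_recursion hbsum hcsum hc0 hrec hz
  have hb0 : orderedIntegral 0 (vacuumIntegrand β ((shibaOneBody (fun x y : FermionTorus 2 L => if (fermionTorusGraph 2 L).Adj x y then -(1 : ℂ) else 0)
          (fun u v : FermionTorus 2 L => -(h : ℂ) * ∑ i : Fin 2,
            if v = FermionTorus.ofTorusSite (u.toTorusSite + Pi.single i 1) then
              ((Real.sqrt 2 * (if i = 0 then 1 else -1) : ℝ) : ℂ) else 0) μ (U : ℂ)))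
      (Matrix.partitionFn β (dGamma ((shibaOneBody (fun x y : FermionTorus 2 L => if (fermionTorusGraph 2 L).Adj x y then -(1 : ℂ) else 0)
          (fun u v : FermionTorus 2 L => -(h : ℂ) * ∑ i : Fin 2,
            if v = FermionTorus.ofTorusSite (u.toTorusSite + Pi.single i 1) then
              ((Real.sqrt 2 * (if i = 0 then 1 else -1) : ℝ) : ℂ) else 0) μ (U : ℂ))))) 0) 1 =
      Matrix.partitionFn β (dGamma ((shibaOneBody (fun x y : FermionTorus 2 L => if (fermionTorusGraph 2 L).Adj x y then -(1 : ℂ) else 0)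
          (fun u v : FermionTorus 2 L => -(h : ℂ) * ∑ i : Fin 2,
            if v = FermionTorus.ofTorusSite (u.toTorusSite + Pi.single i 1) then
              ((Real.sqrt 2 * (if i = 0 then 1 else -1) : ℝ) : ℂ) else 0) μ (U : ℂ)))) := by
    unfold vacuumIntegrand
    rw [orderedIntegral_zero, pow_zero, one_mul, Fintype.sum_unique]
    haveI : IsEmpty (Fin (0 * 2)) := by rw [Nat.zero_mul]; infer_instance
    rw [Matrix.det_isEmpty, mul_one]
  rw [hb0] at key
  have hsU : Summable fun k => orderedIntegral k (vacuumIntegrand β ((shibaOneBody (fun x y : FermionTorus 2 L => if (fermionTorusGraph 2 L).Adj x y then -(1 : ℂ) else 0)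
          (fun u v : FermionTorus 2 L => -(h : ℂ) * ∑ i : Fin 2,
            if v = FermionTorus.ofTorusSite (u.toTorusSite + Pi.single i 1) then
              ((Real.sqrt 2 * (if i = 0 then 1 else -1) : ℝ) : ℂ) else 0) μ (U : ℂ)))
      (Matrix.partitionFn β (dGamma ((shibaOneBody (fun x y : FermionTorus 2 L => if (fermionTorusGraph 2 L).Adj x y then -(1 : ℂ) else 0)
          (fun u v : FermionTorus 2 L => -(h : ℂ) * ∑ i : Fin 2,
            if v = FermionTorus.ofTorusSite (u.toTorusSite + Pi.single i 1) then
              ((Real.sqrt 2 * (if i = 0 then 1 else -1) : ℝ) : ℂ) else 0) μ (U : ℂ))))) k) 1 * z ^ k := by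
    refine Summable.of_norm ?_
    refine (hbsum ‖z‖ (norm_nonneg z) hz).congr fun k => ?_
    rw [norm_mul, norm_pow]
  have h2 := hsU.hasSum
  rw [key] at h2
  have hfun : (fun m : ℕ => z ^ m * orderedIntegral m (vacuumIntegrand β ((shibaOneBody (fun x y : FermionTorus 2 L => if (fermionTorusGraph 2 L).Adj x y then -(1 : ℂ) else 0)
          (fun u v : FermionTorus 2 L => -(h : ℂ) * ∑ i : Fin 2,
            if v = FermionTorus.ofTorusSite (u.toTorusSite + Pi.single i 1) then
              ((Real.sqrt 2 * (if i = 0 then 1 else -1) : ℝ) : ℂ) else 0) μ (U : ℂ)))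
      (Matrix.partitionFn β (dGamma ((shibaOneBody (fun x y : FermionTorus 2 L => if (fermionTorusGraph 2 L).Adj x y then -(1 : ℂ) else 0)
          (fun u v : FermionTorus 2 L => -(h : ℂ) * ∑ i : Fin 2,
            if v = FermionTorus.ofTorusSite (u.toTorusSite + Pi.single i 1) then
              ((Real.sqrt 2 * (if i = 0 then 1 else -1) : ℝ) : ℂ) else 0) μ (U : ℂ))))) m) 1) =
      fun m => orderedIntegral m (vacuumIntegrand β ((shibaOneBody (fun x y : FermionTorus 2 L => if (fermionTorusGraph 2 L).Adj x y then -(1 : ℂ) else 0)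
          (fun u v : FermionTorus 2 L => -(h : ℂ) * ∑ i : Fin 2,
            if v = FermionTorus.ofTorusSite (u.toTorusSite + Pi.single i 1) then
              ((Real.sqrt 2 * (if i = 0 then 1 else -1) : ℝ) : ℂ) else 0) μ (U : ℂ)))
        (Matrix.partitionFn β (dGamma ((shibaOneBody (fun x y : FermionTorus 2 L => if (fermionTorusGraph 2 L).Adj x y then -(1 : ℂ) else 0)
          (fun u v : FermionTorus 2 L => -(h : ℂ) * ∑ i : Fin 2,
            if v = FermionTorus.ofTorusSite (u.toTorusSite + Pi.single i 1) then
              ((Real.sqrt 2 * (if i = 0 then 1 else -1) : ℝ) : ℂ) else 0) μ (U : ℂ))))) m) 1 * z ^ m :=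
    funext fun m => mul_comm _ _
  rw [hfun]
  convert h2 using 3

/-- **Finite-temperature perturbation theory of the `d`-wave–sourced Hubbard torus converges uniformly in
the volume and in the source.** With `κ, R, A` as in `dWaveSourceTorus_connectedCoeff_bound_and_exp`, for
all `L ≥ 3`, `|h| ≤ κ` and real `U` with `|U| ≤ κ`, `|U| < R`:
`Tr e^{-β·dWaveSourceTorus L U μ h} = e^{βμL²} · Z₀(𝓚) · exp(Σ_{j ≥ 1} c_j(L; U, h) (-U)^j)`, where
`‖c_j‖ ≤ L² A R^{-j}`: the interaction correction to the sourced pressure,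
`(βL²)⁻¹ Σ_j c_j (-U)^j`, is analytic-in-size `O(|U|)` uniformly in `L` and in `|h| ≤ κ`.
[cite: BenfattoGiulianiMastropietro2006, (2.77)] -/
theorem partitionFn_dWaveSourceTorus_eq_exp_connected (hβ : 0 ≤ β) :
    ∃ κ : ℝ, 0 < κ ∧ ∃ R : ℝ, 0 < R ∧ ∃ A : ℝ, 0 ≤ A ∧ ∀ (L : ℕ) [NeZero L], 3 ≤ L →
      ∀ (h U : ℝ), |h| ≤ κ → |U| ≤ κ → |U| < R →
      (∀ j : ℕ, 1 ≤ j →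
        ‖orderedIntegral j (fun v : Fin j → ℝ => (-(β : ℂ)) ^ j * ∑ g : Fin j → FermionTorus 2 L,
            ursellOf (FermionicTree.moment (vacuumCluster j)
              (vacuumPropMatrix β ((shibaOneBody (fun x y : FermionTorus 2 L => if (fermionTorusGraph 2 L).Adj x y then -(1 : ℂ) else 0)
          (fun u v : FermionTorus 2 L => -(h : ℂ) * ∑ i : Fin 2,
            if v = FermionTorus.ofTorusSite (u.toTorusSite + Pi.single i 1) then
              ((Real.sqrt 2 * (if i = 0 then 1 else -1) : ℝ) : ℂ) else 0) μ (U : ℂ))) g (fun i => ((v i : ℝ) : ℂ) * -(β : ℂ)))) univ) 1‖ ≤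
          (L : ℝ) ^ 2 * A * R⁻¹ ^ j) ∧
      Matrix.partitionFn β (dWaveSourceTorus L U μ h) =
        (Real.exp (β * (μ * (L : ℝ) ^ 2)) : ℂ) * Matrix.partitionFn β (dGamma ((shibaOneBody (fun x y : FermionTorus 2 L => if (fermionTorusGraph 2 L).Adj x y then -(1 : ℂ) else 0)
          (fun u v : FermionTorus 2 L => -(h : ℂ) * ∑ i : Fin 2,
            if v = FermionTorus.ofTorusSite (u.toTorusSite + Pi.single i 1) then
              ((Real.sqrt 2 * (if i = 0 then 1 else -1) : ℝ) : ℂ) else 0) μ (U : ℂ)))) *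
          Complex.exp (∑' j : ℕ, (if j = 0 then 0 else
            orderedIntegral j (fun v : Fin j → ℝ => (-(β : ℂ)) ^ j * ∑ g : Fin j → FermionTorus 2 L,
              ursellOf (FermionicTree.moment (vacuumCluster j)
                (vacuumPropMatrix β ((shibaOneBody (fun x y : FermionTorus 2 L => if (fermionTorusGraph 2 L).Adj x y then -(1 : ℂ) else 0)
          (fun u v : FermionTorus 2 L => -(h : ℂ) * ∑ i : Fin 2,
            if v = FermionTorus.ofTorusSite (u.toTorusSite + Pi.single i 1) then
              ((Real.sqrt 2 * (if i = 0 then 1 else -1) : ℝ) : ℂ) else 0) μ (U : ℂ))) g (fun i => ((v i : ℝ) : ℂ) * -(β : ℂ)))) univ) 1) *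
            (-(U : ℂ)) ^ j) := by
  obtain ⟨κ, hκ, R, hR, A, hA, hmain⟩ := dWaveSourceTorus_connectedCoeff_bound_and_exp β μ hβ
  refine ⟨κ, hκ, R, hR, A, hA, fun L _ hL h U hh hU hUR => ?_⟩
  obtain ⟨hcoef, hexp⟩ := hmain L hL h U hh hU
  refine ⟨hcoef, ?_⟩
  have hK : ((shibaOneBody (fun x y : FermionTorus 2 L => if (fermionTorusGraph 2 L).Adj x y then -(1 : ℂ) else 0)
          (fun u v : FermionTorus 2 L => -(h : ℂ) * ∑ i : Fin 2,
            if v = FermionTorus.ofTorusSite (u.toTorusSite + Pi.single i 1) then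
              ((Real.sqrt 2 * (if i = 0 then 1 else -1) : ℝ) : ℂ) else 0) μ (U : ℂ))).IsHermitian := by
    refine isHermitian_shibaOneBody (fun x y => ?_) _ μ U
    simp only [apply_ite star, star_neg, star_one, star_zero, (fermionTorusGraph 2 L).adj_comm x y]
  -- the Dyson series of the Shiba form at the real coupling `-U` (same cast form on both sides)
  have hz : ‖((-U : ℝ) : ℂ)‖ < R := by rwa [Complex.norm_real, Real.norm_eq_abs, abs_neg]
  have h1 := hexp ((-U : ℝ) : ℂ) hz
  have h2 := hasSum_vacuumIntegrand hK β (-U)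
  have h12 := h1.unique h2
  rw [Complex.ofReal_neg] at h12
  -- the bridge: `Z(dWaveSourceTorus) = e^{βμL²} Z(dΓ(𝓚) - U D)` (Lieb/Shiba)
  have hcard : (Fintype.card (FermionTorus 2 L) : ℂ) = (L : ℂ) ^ 2 := by
    simp [FermionTorus, Fintype.card_lex]
  have hdiag : (∑ x : FermionTorus 2 L,
      ((if (fermionTorusGraph 2 L).Adj x x then -(1 : ℂ) else 0) - μ)) = -((μ : ℂ) * (L : ℂ) ^ 2) := by
    simp only [SimpleGraph.irrefl, if_false, zero_sub, Finset.sum_neg_distrib, Finset.sum_const,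
      Finset.card_univ, nsmul_eq_mul, hcard]
    ring
  have hshiba := partitionFn_bdgBondHamiltonian_add_onSite_eq_shiba (Λ := FermionTorus 2 L)
    (fun x y : FermionTorus 2 L => if (fermionTorusGraph 2 L).Adj x y then -(1 : ℂ) else 0)
    (fun u v : FermionTorus 2 L => -(h : ℂ) * ∑ i : Fin 2,
      if v = FermionTorus.ofTorusSite (u.toTorusSite + Pi.single i 1) then
        ((Real.sqrt 2 * (if i = 0 then 1 else -1) : ℝ) : ℂ) else 0) μ (U : ℂ) β
  rw [hdiag, show -(β : ℂ) * -((μ : ℂ) * (L : ℂ) ^ 2) = ((β * (μ * (L : ℝ) ^ 2) : ℝ) : ℂ) by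
      push_cast; ring, ← Complex.ofReal_exp, ← h12] at hshiba
  have hbridge : Matrix.partitionFn β (dWaveSourceTorus L U μ h) =
      Matrix.partitionFn β (bdgBondHamiltonian
        (fun x y : FermionTorus 2 L => if (fermionTorusGraph 2 L).Adj x y then -(1 : ℂ) else 0)
        (fun u v : FermionTorus 2 L => -(h : ℂ) * ∑ i : Fin 2,
          if v = FermionTorus.ofTorusSite (u.toTorusSite + Pi.single i 1) then
            ((Real.sqrt 2 * (if i = 0 then 1 else -1) : ℝ) : ℂ) else 0) μ +
        (U : ℂ) • ∑ x : FermionTorus 2 L, numberOp x 0 * numberOp x 1) := by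
    rw [dWaveSourceTorus_eq_bdgBondHamiltonian_add]
    -- the two sides differ only by the `DecidableEq` instance path inside the pairing amplitude
    refine congrArg (fun Δ' : FermionTorus 2 L → FermionTorus 2 L → ℂ =>
      Matrix.partitionFn β (bdgBondHamiltonian
        (fun x y : FermionTorus 2 L => if (fermionTorusGraph 2 L).Adj x y then -(1 : ℂ) else 0) Δ' μ +
        (U : ℂ) • ∑ x : FermionTorus 2 L, numberOp x 0 * numberOp x 1)) ?_
    funext u v
    congr 1
    refine Finset.sum_congr rfl fun i _ => ?_
    congr
  rw [hbridge, hshiba, mul_assoc]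

end Coefficients

end Literature.MathematicalPhysics.QuantumLattice
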